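import Literature.Geometry.Kaehler.WirtingerAreaFormula
import Literature.Geometry.Kaehler.ChainRadialMongeAmpere
import Literature.Geometry.Kaehler.ComplexFrameOrientation
import Literature.Geometry.GeometricMeasureTheory.ChartCurrent
import HarnessLib

/-!
# Integration of pulled-back forms over a sheet of a holomorphic chain (projection formula, local form)

Let `T` be a holomorphic `p`-chain (`p = q + 1`) on an open subset `Ω` of a finite-dimensional
complex inner product space `V`, `ℓ : V → P` a continuous complex-linear map onto a `p`-dimensional
complex inner product space `P`, and `s : W → V` a **holomorphic section of `ℓ` over an open set
`W ⊆ P` parametrising a relatively open piece of the carrier** (`ℓ (s w) = w`, `s(W) ⊆ reg|T|`, and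
near each `s w` the carrier lies in `s(W)`): a *sheet* of the analytic cover `ℓ : |T| → P`. Then

* the approximate tangent space of `reg|T|` at `s t` is `im Ds(t)`
  (`approxTangentCone_carrier_eq_range_of_section`), so the orientation `ξ_T(s t)` is the real
  frame of a unitary basis of `im Ds(t)` (`exists_orientationFrame_eq_of_section`);
* **Jacobian cancellation** (`apply_orientationFrame_mul_normDet_sq_of_section`): for every real
  `2p`-covector `Φ` on `P`, `(ℓ^*Φ)(ξ_T(s t)) · J_{2p}(Ds(t)) = Φ(e₀, i e₀, …)` for any unitary basis
  `e` of `P`, where `J_{2p}(Ds) = normDet (Ds)²` is the real Jacobian (complex-linear maps preserve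
  the canonical orientations; `apply_comp_complexFrame_eq_normDet_mul`);
* hence, by the area formula (Wirtinger form, `lintegral_image_eq_lintegral_mul_normDet_sq`),
  **the sheet formula** `lintegral_image_section_eq`:
  `∫_{s(S)} (ℓ^*Φ)(ξ_T) d𝓗^{2p} = ∫_S Φ(w)(e₀, i e₀, …) d𝓗^{2p}(w)` for measurable `S ⊆ W` and
  continuous non-negative... (stated with `ENNReal.ofReal`, any continuous covector field `Φ`).

Summing over the sheets of a `k`-sheeted cover gives `∫_{reg A ∩ ℓ⁻¹(G)} ℓ^*Φ = k ∫_G Φ`, the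
projection formula used in the Monge–Ampère proof of `n(A, a) = μ_a(A)` [Chirka1989, §15.1;
Demailly, Ch. III (7.4)].

## References

* E. M. Chirka, *Complex Analytic Sets*, Kluwer 1989, §11.1–11.2 (multiplicity of projections),
  §14.1 (Wirtinger), §15.1 [Chirka1989].
* H. Federer, *Geometric Measure Theory*, 1969, 3.2.5, 3.2.19, 4.1.28 [Federer1969].
-/

noncomputable section

open scoped Manifold Topology ENNReal NNReal InnerProductSpace
open Set Filter MeasureTheory Metric Module Function

universe u

namespace Literature.Geometry.Kaehler

open Literature.Geometry.GeometricMeasureTheory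

variable {V : Type u} [NormedAddCommGroup V] [InnerProductSpace ℂ V] [FiniteDimensional ℂ V]
  [MeasurableSpace V] [BorelSpace V] {Ω : TopologicalSpace.Opens V} {q : ℕ}
  {P : Type*} [NormedAddCommGroup P] [InnerProductSpace ℂ P] [FiniteDimensional ℂ P]
  [MeasurableSpace P] [BorelSpace P]

namespace HolomorphicChain

/-! ### Sections of a linear map -/

omit [FiniteDimensional ℂ V] [MeasurableSpace V] [BorelSpace V] [FiniteDimensional ℂ P]
  [MeasurableSpace P] [BorelSpace P] in
/-- Differentiating `ℓ ∘ s = id` on the open set `W`: `ℓ ∘ Ds(t) = id`. [folklore] -/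
theorem comp_fderiv_eq_of_section (ℓ : V →L[ℂ] P) {W : Set P} (hW : IsOpen W) {s : P → V}
    (hs : DifferentiableOn ℂ s W) (hℓs : ∀ w ∈ W, ℓ (s w) = w) {t : P} (ht : t ∈ W) (x : P) :
    ℓ (fderiv ℂ s t x) = x := by
  have hd : HasFDerivAt s (fderiv ℂ s t) t := (hs.differentiableAt (hW.mem_nhds ht)).hasFDerivAt
  have h1 : HasFDerivAt (fun w => ℓ (s w)) (ℓ.comp (fderiv ℂ s t)) t := ℓ.hasFDerivAt.comp t hd
  have h2 : HasFDerivAt (fun w => ℓ (s w)) (ContinuousLinearMap.id ℂ P) t :=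
    (hasFDerivAt_id t).congr_of_eventuallyEq (eventually_of_mem (hW.mem_nhds ht) fun w hw => hℓs w hw)
  have := h1.unique h2
  simpa using congrArg (fun A : P →L[ℂ] P => A x) this

omit [FiniteDimensional ℂ V] [MeasurableSpace V] [BorelSpace V] [FiniteDimensional ℂ P]
  [MeasurableSpace P] [BorelSpace P] in
/-- The differential of a section is injective. [folklore] -/
theorem injective_fderiv_of_section (ℓ : V →L[ℂ] P) {W : Set P} (hW : IsOpen W) {s : P → V}
    (hs : DifferentiableOn ℂ s W) (hℓs : ∀ w ∈ W, ℓ (s w) = w) {t : P} (ht : t ∈ W) :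
    Injective (fderiv ℂ s t) := fun a b h => by
  rw [← comp_fderiv_eq_of_section ℓ hW hs hℓs ht a, ← comp_fderiv_eq_of_section ℓ hW hs hℓs ht b, h]

/-! ### The orientation frame together with its span -/

/-- At a carrier point, the orientation frame is the real frame of a unitary `p`-frame whose real
span is the approximate tangent space. [cite: Chirka1989, §14.1, p. 174] -/
theorem exists_orientationFrame_eq_complexFrame_span {p : ℕ} (T : HolomorphicChain 𝓘(ℂ, V) Ω p)
    {v : V} (hv : v ∈ T.carrier) :
    ∃ u : Fin p → V, Orthonormal ℂ u ∧
      ((Submodule.span ℝ (Set.range (complexFrame u)) : Set V) =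
        approxTangentCone (2 * p) ((μHE[2 * p] : Measure V).restrict T.carrier) v) ∧
      T.orientationFrame v = complexFrame u := by
  classical
  have h := T.exists_orthonormal_span_eq_approxTangentCone hv
  refine ⟨h.choose, h.choose_spec.1, h.choose_spec.2, ?_⟩
  unfold HolomorphicChain.orientationFrame
  rw [dif_pos h]

/-! ### The tangent space of a sheet -/

omit [MeasurableSpace V] [BorelSpace V] [MeasurableSpace P] [BorelSpace P] in
/-- A holomorphic map on an open subset of a finite-dimensional space is real `C¹` at its points. [folklore] -/
theorem contDiffAt_real_of_differentiableOn {W : Set P} (hW : IsOpen W) {s : P → V}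
    (hs : DifferentiableOn ℂ s W) {t : P} (ht : t ∈ W) : ContDiffAt ℝ 1 s t :=
  (((Literature.Analysis.Complex.SCV.analyticOnNhd_of_differentiableOn hs hW).contDiffOn
    (n := 1) hW.uniqueDiffOn).contDiffAt (hW.mem_nhds ht)).restrict_scalars ℝ

/-- **The approximate tangent space of the carrier along a sheet is the tangent space of the
sheet**: `Tan^{2p}(𝓗^{2p} ⌞ reg|T|, s t) = im Ds(t)` for a holomorphic section `s` of `ℓ` over
the open `W ∋ t` parametrising the carrier near `s t`. [cite: Federer1969, 3.2.19] -/
theorem approxTangentCone_carrier_eq_range_of_section (T : HolomorphicChain 𝓘(ℂ, V) Ω (q + 1))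
    (hP : finrank ℂ P = q + 1) (ℓ : V →L[ℂ] P) {W : Set P} (hW : IsOpen W) {s : P → V}
    (hs : DifferentiableOn ℂ s W) (hℓs : ∀ w ∈ W, ℓ (s w) = w) (hsW : s '' W ⊆ T.carrier) {t : P}
    (ht : t ∈ W) {N : Set V} (hN : N ∈ 𝓝 (s t)) (hNc : T.carrier ∩ N ⊆ s '' W) :
    approxTangentCone (2 * (q + 1)) ((μHE[2 * (q + 1)] : Measure V).restrict T.carrier) (s t) =
      Set.range (fderiv ℂ s t) := by
  letI : InnerProductSpace ℝ P := InnerProductSpace.complexToReal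
  haveI : FiniteDimensional ℝ P := FiniteDimensional.complexToReal P
  have h2p : finrank ℝ P = 2 * (q + 1) := by rw [finrank_real_of_complex, hP]
  -- Lipschitz data
  have hK : 0 < max ‖(ℓ.restrictScalars ℝ : V →L[ℝ] P)‖₊ 1 := lt_max_of_lt_right one_pos
  have hℓL : LipschitzWith (max ‖(ℓ.restrictScalars ℝ : V →L[ℝ] P)‖₊ 1) ℓ :=
    ((ℓ.restrictScalars ℝ).lipschitz).weaken (le_max_left _ _)
  obtain ⟨L, W₀, hW₀, hLip⟩ := (contDiffAt_real_of_differentiableOn hW hs ht).exists_lipschitzOnWith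
  have hW' : W₀ ∩ W ∈ 𝓝 t := inter_mem hW₀ (hW.mem_nhds ht)
  have hsL : LipschitzOnWith L s (W₀ ∩ W) := hLip.mono inter_subset_left
  have hℓs' : ∀ w ∈ W₀ ∩ W, ℓ (s w) = w := fun w hw => hℓs w hw.2
  have hsd : HasFDerivAt s ((fderiv ℂ s t).restrictScalars ℝ) t :=
    ((hs.differentiableAt (hW.mem_nhds ht)).hasFDerivAt).restrictScalars ℝ
  have hC : s '' (W₀ ∩ W) ⊆ T.carrier := (image_mono inter_subset_right).trans hsW
  -- an open neighbourhood `U ⊆ N ∩ ℓ⁻¹ W` of `s t`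
  obtain ⟨U, hUsub, hUo, hU⟩ := _root_.mem_nhds_iff.1 (inter_mem hN ((hW.preimage ℓ.continuous).mem_nhds
    (show s t ∈ ℓ ⁻¹' W by rw [mem_preimage, hℓs t ht]; exact ht)))
  -- the level set `F y = y - s (ℓ y)`
  set F : V → V := fun y => y - s (ℓ y) with hF
  have hFd : HasFDerivAt F (ContinuousLinearMap.id ℝ V -
      ((fderiv ℂ s t).restrictScalars ℝ).comp (ℓ.restrictScalars ℝ)) (s t) := by
    have h1 : HasFDerivAt (fun y => s (ℓ y)) (((fderiv ℂ s (ℓ (s t))).restrictScalars ℝ).comp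
        (ℓ.restrictScalars ℝ)) (s t) := by
      have hd : HasFDerivAt s ((fderiv ℂ s (ℓ (s t))).restrictScalars ℝ) (ℓ (s t)) := by
        rw [hℓs t ht]; exact hsd
      exact hd.comp (s t) (ℓ.restrictScalars ℝ).hasFDerivAt
    rw [hℓs t ht] at h1
    exact (hasFDerivAt_id (s t)).sub h1
  have hCU : T.carrier ∩ U ⊆ {z | F z = F (s t)} := by
    rintro z ⟨hz, hzU⟩
    obtain ⟨w, hw, rfl⟩ := hNc ⟨hz, (hUsub hzU).1⟩
    simp only [mem_setOf_eq, hF, hℓs w hw, hℓs t ht, sub_self]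
  have hker : ∀ y, (ContinuousLinearMap.id ℝ V -
      ((fderiv ℂ s t).restrictScalars ℝ).comp (ℓ.restrictScalars ℝ)) y = 0 →
      y ∈ Set.range ((fderiv ℂ s t).restrictScalars ℝ) := by
    intro y hy
    refine ⟨ℓ y, ?_⟩
    have : y - fderiv ℂ s t (ℓ y) = 0 := hy
    rw [sub_eq_zero] at this
    exact this.symm
  have key := approxTangentCone_eq_range_fderiv_of_lipschitz (G := V) hK hℓL hW' hsL hℓs' hsd hC
    T.measurableSet_carrier hUo.measurableSet (hUo.mem_nhds hU) hFd hCU hker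
  rw [h2p] at key
  rw [key]
  rfl

/-- **The orientation of a sheet is the canonical orientation of its tangent space**: at `s t`
the orientation frame of `T` is the real frame of a unitary `p`-frame spanning `im Ds(t)`.
[cite: Chirka1989, §14.1, p. 174] -/
theorem exists_orientationFrame_eq_of_section (T : HolomorphicChain 𝓘(ℂ, V) Ω (q + 1))
    (hP : finrank ℂ P = q + 1) (ℓ : V →L[ℂ] P) {W : Set P} (hW : IsOpen W) {s : P → V}
    (hs : DifferentiableOn ℂ s W) (hℓs : ∀ w ∈ W, ℓ (s w) = w) (hsW : s '' W ⊆ T.carrier) {t : P}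
    (ht : t ∈ W) {N : Set V} (hN : N ∈ 𝓝 (s t)) (hNc : T.carrier ∩ N ⊆ s '' W) :
    ∃ u : Fin (q + 1) → V, Orthonormal ℂ u ∧
      ((Submodule.span ℝ (Set.range (complexFrame u)) : Set V) = Set.range (fderiv ℂ s t)) ∧
      T.orientationFrame (s t) = complexFrame u := by
  obtain ⟨u, hu, hspan, hξ⟩ := T.exists_orientationFrame_eq_complexFrame_span (hsW ⟨t, ht, rfl⟩)
  rw [T.approxTangentCone_carrier_eq_range_of_section hP ℓ hW hs hℓs hsW ht hN hNc] at hspan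
  exact ⟨u, hu, hspan, hξ⟩

/-! ### Jacobian cancellation -/

/-- **Jacobian cancellation on a sheet.** For every real `2p`-covector `Φ` on `P` and unitary basis
`e` of `P`: `Φ(ℓ ∘ ξ_T(s t)) · normDet (Ds(t))² = Φ(e₀, i e₀, …)` — the pulled-back form evaluated
on the orientation of the sheet, times the real Jacobian `J_{2p}(Ds) = (normDet Ds)²` of the
parametrisation, is the form evaluated on the canonical frame of the base.
[cite: Federer1969, 4.1.28, 3.2.5; Chirka1989, §14.1 Lemma 1] -/
theorem apply_orientationFrame_mul_normDet_sq_of_section (T : HolomorphicChain 𝓘(ℂ, V) Ω (q + 1))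
    (hP : finrank ℂ P = q + 1) (ℓ : V →L[ℂ] P) {W : Set P} (hW : IsOpen W) {s : P → V}
    (hs : DifferentiableOn ℂ s W) (hℓs : ∀ w ∈ W, ℓ (s w) = w) (hsW : s '' W ⊆ T.carrier) {t : P}
    (ht : t ∈ W) {N : Set V} (hN : N ∈ 𝓝 (s t)) (hNc : T.carrier ∩ N ⊆ s '' W)
    (Φ : P [⋀^Fin (2 * (q + 1))]→L[ℝ] ℝ) (e : OrthonormalBasis (Fin (q + 1)) ℂ P) :
    Φ (fun i => ℓ (T.orientationFrame (s t) i)) * (fderiv ℂ s t : P →ₗ[ℂ] V).normDet ^ 2 =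
      Φ (complexFrame e) := by
  letI : InnerProductSpace ℝ P := InnerProductSpace.complexToReal
  obtain ⟨u, hu, hspan, hξ⟩ := T.exists_orientationFrame_eq_of_section hP ℓ hW hs hℓs hsW ht hN hNc
  have key := apply_comp_complexFrame_eq_normDet_mul e (fderiv ℂ s t) hu hspan
    (Φ.compContinuousLinearMap (ℓ.restrictScalars ℝ))
  rw [ContinuousAlternatingMap.compContinuousLinearMap_apply,
    ContinuousAlternatingMap.compContinuousLinearMap_apply] at key
  have hnd := normDet_restrictScalars_eq_normDet_sq (fderiv ℂ s t : P →ₗ[ℂ] V)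
  have hcomp : (⇑(ℓ.restrictScalars ℝ) ∘ (⇑(fderiv ℂ s t) ∘ complexFrame ⇑e)) = complexFrame ⇑e := by
    have h1 : (⇑(ℓ.restrictScalars ℝ) ∘ (⇑(fderiv ℂ s t) ∘ complexFrame ⇑e)) =
        ⇑((ℓ : V →ₗ[ℂ] P).comp (fderiv ℂ s t : P →ₗ[ℂ] V)) ∘ complexFrame ⇑e := rfl
    rw [h1, ← map_complexFrame]
    congr 1
    funext j
    exact comp_fderiv_eq_of_section ℓ hW hs hℓs ht (e j)
  rw [hcomp] at key
  rw [hξ]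
  change Φ (⇑(ℓ.restrictScalars ℝ) ∘ complexFrame u) * _ = _
  rw [← hnd, mul_comm]
  exact key.symm

/-! ### The area formula for a.e.-measurable integrands -/

omit [MeasurableSpace P] [BorelSpace P] [FiniteDimensional ℂ P] [InnerProductSpace ℂ P] in
/-- **Wirtinger's change of variables for a.e.-measurable integrands**: the area formula
`∫_{F(S)} g d𝓗^{2p} = ∫_S g(F x) (normDet ∂F(x))² d𝓗^{2p}(x)` for an injective holomorphic immersion
`F` on the open `U ⊇ S`, with `g` merely a.e.-measurable for `𝓗^{2p} ⌞ F(S)` (a null set of the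
image has null preimage in `S`, the Jacobian being positive). [cite: Federer1969, 3.2.5] -/
theorem lintegral_image_eq_lintegral_mul_normDet_sq_of_aemeasurable {E : Type*}
    [NormedAddCommGroup E] [InnerProductSpace ℂ E] [FiniteDimensional ℂ E] [MeasurableSpace E]
    [BorelSpace E] {F : E → V} {U : Set E} (hU : IsOpen U) (hF : DifferentiableOn ℂ F U)
    (hinj : InjOn F U) (himm : ∀ x ∈ U, Injective (fderiv ℂ F x)) {S : Set E}
    (hS : MeasurableSet S) (hSU : S ⊆ U) {g : V → ℝ≥0∞}
    (hg : AEMeasurable g ((μHE[2 * finrank ℂ E] : Measure V).restrict (F '' S))) :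
    ∫⁻ y in F '' S, g y ∂(μHE[2 * finrank ℂ E] : Measure V) =
      ∫⁻ x in S, g (F x) * ENNReal.ofReal ((fderiv ℂ F x : E →ₗ[ℂ] V).normDet ^ 2)
        ∂(μHE[2 * finrank ℂ E] : Measure E) := by
  have hF' : ∀ x ∈ U, HasFDerivAt F (fderiv ℂ F x) x := fun x hx =>
    (hF.differentiableAt (hU.mem_nhds hx)).hasFDerivAt
  have hF'c : ContinuousOn (fderiv ℂ F) U :=
    Literature.Analysis.Complex.SCV.continuousOn_fderiv hF hU
  have hFc : ContinuousOn F U := hF.continuousOn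
  have AF : ∀ g' : V → ℝ≥0∞, Measurable g' →
      ∫⁻ y in F '' S, g' y ∂(μHE[2 * finrank ℂ E] : Measure V) =
        ∫⁻ x in S, g' (F x) * ENNReal.ofReal ((fderiv ℂ F x : E →ₗ[ℂ] V).normDet ^ 2)
          ∂(μHE[2 * finrank ℂ E] : Measure E) := fun g' hg' =>
    lintegral_image_eq_lintegral_mul_normDet_sq hU hF' hF'c hinj himm hS hSU hg'
  -- replace `g` by a measurable version
  rw [lintegral_congr_ae hg.ae_eq_mk, AF _ hg.measurable_mk]
  refine lintegral_congr_ae ?_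
  -- the bad set and its measurable hull
  obtain ⟨B, hBsub, hBm, hB0⟩ := exists_measurable_superset_of_null
    (show ((μHE[2 * finrank ℂ E] : Measure V).restrict (F '' S)) {y | g y ≠ hg.mk g y} = 0 from
      ae_iff.1 hg.ae_eq_mk)
  have hind : ∫⁻ x in S, (B.indicator 1 (F x) : ℝ≥0∞) *
      ENNReal.ofReal ((fderiv ℂ F x : E →ₗ[ℂ] V).normDet ^ 2) ∂(μHE[2 * finrank ℂ E] : Measure E) = 0 := by
    rw [← AF _ (measurable_one.indicator hBm), lintegral_indicator hBm]
    simp only [Pi.one_apply, lintegral_one, Measure.restrict_restrict hBm, Measure.restrict_apply_univ]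
    rw [Measure.restrict_apply hBm] at hB0
    exact hB0
  have hJm : AEMeasurable (fun x => ENNReal.ofReal ((fderiv ℂ F x : E →ₗ[ℂ] V).normDet ^ 2))
      ((μHE[2 * finrank ℂ E] : Measure E).restrict S) := by
    set e := stdOrthonormalBasis ℂ E with he
    -- `(normDet L)² = Re det Gram(L e)` is continuous in `L`
    have h1 : Continuous fun L : E →L[ℂ] V => ((Matrix.gram ℂ ((L : E →ₗ[ℂ] V) ∘ e)).det).re := by
      refine Complex.continuous_re.comp (Continuous.matrix_det ?_)
      refine continuous_pi fun i => continuous_pi fun j => ?_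
      simp only [Matrix.gram, Matrix.of_apply, Function.comp_apply, ContinuousLinearMap.coe_coe]
      exact ((ContinuousLinearMap.apply ℂ V (e i)).continuous).inner
        ((ContinuousLinearMap.apply ℂ V (e j)).continuous)
    have hc : ContinuousOn (fun x => (fderiv ℂ F x : E →ₗ[ℂ] V).normDet ^ 2) U := by
      have := h1.comp_continuousOn hF'c
      refine this.congr fun x _ => ?_
      simp only [Function.comp_apply]
      rw [re_det_gram_complex_eq_normDet_sq]
    exact ENNReal.measurable_ofReal.comp_aemeasurable ((hc.mono hSU).aemeasurable hS)
  have hBFm : AEMeasurable (fun x => (B.indicator 1 (F x) : ℝ≥0∞))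
      ((μHE[2 * finrank ℂ E] : Measure E).restrict S) :=
    (measurable_one.indicator hBm).comp_aemeasurable ((hFc.mono hSU).aemeasurable hS)
  have hae := (lintegral_eq_zero_iff' (hBFm.mul hJm)).1 hind
  filter_upwards [hae, ae_restrict_mem hS] with x hx hxS
  have hJ : ENNReal.ofReal ((fderiv ℂ F x : E →ₗ[ℂ] V).normDet ^ 2) ≠ 0 := by
    rw [ne_eq, ENNReal.ofReal_eq_zero, not_le]
    have hnd : (fderiv ℂ F x : E →ₗ[ℂ] V).normDet ≠ 0 := by
      rw [ne_eq, LinearMap.normDet_eq_zero_iff_ker_ne_bot, not_not]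
      exact LinearMap.ker_eq_bot.2 (himm x (hSU hxS))
    positivity
  have hFx : F x ∉ B := by
    intro hmem
    simp only [Pi.mul_apply, Pi.zero_apply, mul_eq_zero] at hx
    rcases hx with h | h
    · rw [indicator_of_mem hmem, Pi.one_apply] at h
      exact one_ne_zero h
    · exact hJ h
  have : F x ∉ {y | g y ≠ hg.mk g y} := fun h => hFx (hBsub h)
  have hgx : g (F x) = hg.mk g (F x) := by simpa using this
  rw [hgx]

/-! ### The sheet formula -/

/-- **Integration of a pulled-back form over a sheet.** For a holomorphic section `s` of `ℓ` over
the open `W ⊆ P` parametrising a relatively open piece of the carrier of the `p`-chain `T`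
(`p = q + 1 = dim P`), a continuous field `Φ` of real `2p`-covectors on `P`, a unitary basis `e`
of `P` and measurable `S ⊆ W`:
`∫_{s(S)} Φ(ℓ z)(ℓ ∘ ξ_T(z)) d𝓗^{2p}(z) = ∫_S Φ(w)(e₀, i e₀, …) d𝓗^{2p}(w)` (with `ENNReal.ofReal`
integrands) — the sheet projects with degree one. [cite: Chirka1989, §15.1; Federer1969, 4.1.28] -/
theorem lintegral_image_section_eq (T : HolomorphicChain 𝓘(ℂ, V) Ω (q + 1))
    (hP : finrank ℂ P = q + 1) (ℓ : V →L[ℂ] P) {W : Set P} (hW : IsOpen W) {s : P → V}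
    (hs : DifferentiableOn ℂ s W) (hℓs : ∀ w ∈ W, ℓ (s w) = w) (hsW : s '' W ⊆ T.carrier)
    (hopen : ∀ t ∈ W, ∃ N ∈ 𝓝 (s t), T.carrier ∩ N ⊆ s '' W)
    {Φ : P → P [⋀^Fin (2 * (q + 1))]→L[ℝ] ℝ} (hΦ : Continuous Φ)
    (e : OrthonormalBasis (Fin (q + 1)) ℂ P) {S : Set P} (hSm : MeasurableSet S) (hSW : S ⊆ W) :
    ∫⁻ z in s '' S, ENNReal.ofReal (Φ (ℓ z) (fun i => ℓ (T.orientationFrame z i)))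
        ∂(μHE[2 * (q + 1)] : Measure V) =
      ∫⁻ w in S, ENNReal.ofReal (Φ w (complexFrame e)) ∂(μHE[2 * (q + 1)] : Measure P) := by
  -- a.e.-measurability of the integrand along the carrier
  set Ψ : V → V [⋀^Fin (2 * (q + 1))]→L[ℝ] ℝ := fun z =>
    (Φ (ℓ z)).compContinuousLinearMap (ℓ.restrictScalars ℝ) with hΨ
  have hΨc : Continuous Ψ :=
    (ContinuousAlternatingMap.compContinuousLinearMapCLM (ℓ.restrictScalars ℝ)).continuous.comp
      (hΦ.comp ℓ.continuous)
  have hΨeq : ∀ z, Ψ z (T.orientationFrame z) = Φ (ℓ z) (fun i => ℓ (T.orientationFrame z i)) :=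
    fun z => rfl
  have hgm : AEMeasurable (fun z => ENNReal.ofReal (Φ (ℓ z) (fun i => ℓ (T.orientationFrame z i))))
      ((μHE[2 * (q + 1)] : Measure V).restrict (s '' S)) := by
    have h1 := (T.aestronglyMeasurable_apply_orientationFrame hΨc).aemeasurable.mono_measure
      (Measure.restrict_mono ((image_mono hSW).trans hsW) le_rfl)
    simp_rw [hΨeq] at h1
    exact h1.ennreal_ofReal
  have himm : ∀ x ∈ W, Injective (fderiv ℂ s x) := fun x hx => injective_fderiv_of_section ℓ hW hs hℓs hx
  have key := lintegral_image_eq_lintegral_mul_normDet_sq_of_aemeasurable hW hs (LeftInvOn.injOn hℓs)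
    himm hSm hSW (g := fun z => ENNReal.ofReal (Φ (ℓ z) (fun i => ℓ (T.orientationFrame z i))))
    (by rw [hP]; exact hgm)
  rw [hP] at key
  rw [key]
  refine setLIntegral_congr_fun hSm fun x hx => ?_
  obtain ⟨N, hN, hNc⟩ := hopen x (hSW hx)
  rw [hℓs x (hSW hx), ← ENNReal.ofReal_mul' (sq_nonneg _),
    T.apply_orientationFrame_mul_normDet_sq_of_section hP ℓ hW hs hℓs hsW (hSW hx) hN hNc (Φ x) e]

end HolomorphicChain

end Literature.Geometry.Kaehler

end
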